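/-
Origin: expansion seat `planner-pub-hodgecm-pv05-g3-0`, handover #4 2026-08-18T05:52:02Z (`HOME/pub-hodgecm-pv05-g3/lean/Pv05g3/FockLieModule.lean`, md5 9eb2a21e, 301 lines);
landed by the gen-6 packager in gate run 24 as `HodgeCM/PerL34/FockLieModule.lean` (verbatim).
-/
/-
Origin: HOME/pub-hodgecm-pv05-g3/lean/Pv05g3/FockLieModule.lean — session planner-pub-hodgecm-pv05-g3-0 (unit
pub-hodgecm-pv05-g3, DAG-node prover #05 gen 3).  Intended final place: `HodgeCM/PerL34/FockLieModule.lean`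
(namespace `HodgeCM.PerL34.Fock`).  Imports the LANDED `HodgeCM.PerL34.FockLowestWeight` (run 23) and
Mathlib only — no `Pv05g3.*` import left to rewrite; asserts nothing.
-/
import Mathlib.Algebra.Lie.Semisimple.Defs
import Mathlib.RingTheory.MvPolynomial.WeightedHomogeneous
import Mathlib.RingTheory.MvPolynomial.Homogeneous
import Mathlib.Algebra.DirectSum.Decomposition
import Summits.HodgeConjecture.HodgeCM.PerL34.FockLowestWeight

set_option autoImplicit false

/-!
# Howe duality on the polynomial Fock space, in Mathlib's vocabulary: `ℂ[z₁,z₂,w] = ⊕_{k ∈ ℤ} F_k` with the `F_k` irreducible and pairwise non-isomorphic over `𝔤𝔩₃(ℂ)`; `Sym^d ℂ³` likewise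

`FockIrreducible` / `FockGL3` state irreducibility as "every `oscRep`-stable subspace meeting `F_k` non-trivially
contains `F_k`".  This file restates and completes it with MATHLIB'S OWN NOTIONS, so that no home-made definition
stands between the kernel and the words "direct sum", "irreducible", "non-isomorphic":

* `wt_eq_weight`, `wpiece_eq_weightedHomogeneousSubmodule` : our weight pieces ARE Mathlib's
  `weightedHomogeneousSubmodule ℂ s k`; hence (`weightedDecomposition`) **`wpiece_isInternal s :
  DirectSum.IsInternal (fun k : ℤ => wpiece s k)`** for any integer weights and **`hpiece_isInternal :
  DirectSum.IsInternal (fun k : ℤ => hpiece k)`** — `ℂ[z₁,z₂,w] = ⊕_k F_k`, the `U(1)`-isotypic decomposition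
  (`iSup_hpiece_eq_top`, `hpiece_iSupIndep`);

* (scoped instances `instLieRingModuleHarm`, `instLieModuleHarm`) `ℂ[z₁,z₂,w]` is a `LieModule ℂ (Matrix HarmVar
  HarmVar ℂ)` through `oscRep` (`LieRingModule.compLieHom`; `gl3_lie_apply : ⁅A, f⁆ = oscRep A f`);
* `fockPiece k : LieSubmodule ℂ (Matrix HarmVar HarmVar ℂ) HarmModel` — `F_k` (carrier `hpiece k`, `mem_fockPiece`);
* **`fockPiece_isIrreducible k : LieModule.IsIrreducible ℂ (Matrix HarmVar HarmVar ℂ) ↥(fockPiece k)`** for EVERY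
  `k : ℤ` (Mathlib: the lattice of Lie submodules of `F_k` is `{⊥, ⊤}`, `F_k` non-trivial);
* the definite pair `(U(1), U(3))` likewise, completely: `dpiece_eq_homogeneousSubmodule`, **`dpiece_isInternal :
  DirectSum.IsInternal (fun d : ℕ => dpiece d)`** (`ℂ[z₁,z₂,z₃] = ⊕_d Sym^d`, Mathlib's `MvPolynomial.decomposition`),
  scoped `LieModule ℂ (Matrix (Fin 3) (Fin 3) ℂ) DefModel` through `dERep`, `symPiece d` (carrier `dpiece d = Sym^d`),
  **`symPiece_isIrreducible d`**, `dERep_one_apply_of_mem` / `lie_one_symPiece` (the centre acts by `d`),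
  **`symPiece_hom_eq_zero : d ≠ d' → ∀ T : Sym^d →ₗ⁅ℂ,𝔤𝔩₃⁆ Sym^{d'}, T = 0`**.

The instances are `scoped` (activate with `open HodgeCM.PerL34.Fock`) because `HarmModel` / `DefModel` are
abbreviations of plain Mathlib types.  Complete proofs, no hypotheses.

* **`fockPiece_hom_eq_zero : k ≠ k' → ∀ T : F_k →ₗ⁅ℂ,𝔤𝔩₃⁆ F_{k'}, T = 0`** — the `F_k` are pairwise
  NON-ISOMORPHIC `𝔤𝔩₃(ℂ)`-modules (indeed there is no nonzero intertwiner), distinguished by the central character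
  `k + 2` of `FockLowestWeight.oscZ_apply_of_mem`: the injectivity `σ ↦ θ(σ)` of the correspondence on this shell
  (the shape of Adams 2007 Thm 6.3 (2)/(6) for the pair `(U(1), U(2,1))`, here as a statement about these explicit
  modules only).

PACKAGER: no import rewrite needed (imports the landed run-23 tree); same file-local
`attribute [local instance 100] LieRing.ofAssociativeRing` as `FockGL3`.
-/

namespace HodgeCM

namespace PerL34

namespace Fock

open MvPolynomial Finsupp

open scoped BigOperators

attribute [local instance 100] LieRing.ofAssociativeRing

section WeightDecomposition

variable {σ : Type*} [Fintype σ]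

/-- our weight `wt s m = Σ s_i m_i` is Mathlib's `Finsupp.weight s m` -/
theorem wt_eq_weight (s : σ → ℤ) (m : σ →₀ ℕ) : wt s m = Finsupp.weight s m := by
  rw [Finsupp.weight_apply, Finsupp.sum_fintype, wt]
  · exact Finset.sum_congr rfl fun i _ => by rw [nsmul_eq_mul, mul_comm]
  · exact fun i => zero_nsmul (s i)

/-- the weight-`k` piece `wpiece s k` (an eigenspace of the weight operator) IS Mathlib's weighted-homogeneous
submodule for the weights `s` -/
theorem wpiece_eq_weightedHomogeneousSubmodule [DecidableEq σ] (s : σ → ℤ) (k : ℤ) :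
    wpiece s k = weightedHomogeneousSubmodule ℂ s k := by
  ext f
  rw [mem_wpiece_iff_support, mem_weightedHomogeneousSubmodule, IsWeightedHomogeneous]
  simp only [MvPolynomial.mem_support_iff, wt_eq_weight]

/-- **`ℂ[X_σ] = ⊕_{k ∈ ℤ} (weight-k piece)`** (internal direct sum of submodules), for any integer weights. -/
theorem wpiece_isInternal [DecidableEq σ] (s : σ → ℤ) : DirectSum.IsInternal fun k : ℤ => wpiece s k := by
  have h : (fun k : ℤ => wpiece s k) = weightedHomogeneousSubmodule ℂ s :=
    funext (wpiece_eq_weightedHomogeneousSubmodule s)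
  rw [h]
  letI := weightedDecomposition ℂ s
  exact DirectSum.Decomposition.isInternal _

/-- **`ℂ[z₁,z₂,w] = ⊕_{k ∈ ℤ} F_k`**: the Fock model is the internal direct sum of the `U(1)`-isotypic pieces
`F_k = hpiece k` (`u ↦ u^k`).  With `fockPiece_isIrreducible` (each `F_k` irreducible over `𝔤𝔩₃(ℂ)`) and
`fockPiece_hom_eq_zero` (pairwise non-isomorphic) below, this is the complete module-level Howe duality statement for
the pair `(U(1), 𝔤𝔩₃(ℂ) ⊃ 𝔲(2,1))` on the polynomial Fock space: a multiplicity-free decomposition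
`⊕_k (u^k ⊠ F_k)` with `k ↦ F_k` injective. -/
theorem hpiece_isInternal : DirectSum.IsInternal fun k : ℤ => hpiece k :=
  wpiece_isInternal uWt

/-- in particular the `F_k` are independent and span: every polynomial is uniquely a finite sum of its
`F_k`-components -/
theorem iSup_hpiece_eq_top : ⨆ k : ℤ, hpiece k = ⊤ :=
  hpiece_isInternal.submodule_iSup_eq_top

/-- (Ported verbatim from the HodgeCMPerL package; no docstring in the source.) -/
theorem hpiece_iSupIndep : iSupIndep fun k : ℤ => hpiece k :=
  hpiece_isInternal.submodule_iSupIndep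

end WeightDecomposition

section LieModuleStructure

/-- `ℂ[z₁,z₂,w]` as a Lie (ring) module over `𝔤𝔩₃(ℂ) = Matrix HarmVar HarmVar ℂ` through `oscRep` (pull-back of the
tautological `Module.End`-action).  Scoped (activate with `open HodgeCM.PerL34.Fock`), since `HarmModel` is an
abbreviation for a Mathlib type. -/
noncomputable scoped instance instLieRingModuleHarm : LieRingModule (Matrix HarmVar HarmVar ℂ) HarmModel :=
  LieRingModule.compLieHom HarmModel oscRep

/-- (Ported verbatim from the HodgeCMPerL package; no docstring in the source.) -/
theorem gl3_lie_apply (A : Matrix HarmVar HarmVar ℂ) (f : HarmModel) : ⁅A, f⁆ = oscRep A f := rfl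

/-- (Ported verbatim from the HodgeCMPerL package; no docstring in the source.) -/
scoped instance instLieModuleHarm : LieModule ℂ (Matrix HarmVar HarmVar ℂ) HarmModel :=
  LieModule.compLieHom HarmModel oscRep

/-- `F_k` as a Lie submodule of `ℂ[z₁,z₂,w]` over `𝔤𝔩₃(ℂ)`. -/
noncomputable def fockPiece (k : ℤ) : LieSubmodule ℂ (Matrix HarmVar HarmVar ℂ) HarmModel :=
  { hpiece k with
    lie_mem := fun {A f} hf => oscRep_mem_hpiece k A f hf }

/-- (Ported verbatim from the HodgeCMPerL package; no docstring in the source.) -/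
theorem mem_fockPiece (k : ℤ) (f : HarmModel) : f ∈ fockPiece k ↔ f ∈ hpiece k := Iff.rfl

/-- **Each `F_k` is an irreducible Lie module over `𝔤𝔩₃(ℂ)`** (`LieModule.IsIrreducible`, i.e. its lattice of Lie
submodules is `{⊥, ⊤}`), for every `k : ℤ`. -/
theorem fockPiece_isIrreducible (k : ℤ) :
    LieModule.IsIrreducible ℂ (Matrix HarmVar HarmVar ℂ) ↥(fockPiece k) := by
  obtain ⟨n, hn⟩ : ∃ n : ℕ, (k = n) ∨ (k = -n) := by
    rcases Int.eq_nat_or_neg k with ⟨n, h | h⟩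
    · exact ⟨n, Or.inl h⟩
    · exact ⟨n, Or.inr h⟩
  -- a nonzero vector of `F_k`
  obtain ⟨v, hvk, hv0⟩ : ∃ v : HarmModel, v ∈ hpiece k ∧ v ≠ 0 := by
    rcases hn with h | h
    · exact ⟨hmon 0 n 0, by rw [h]; simpa using hmon_mem_hpiece 0 n 0, hmon_ne_zero 0 n 0⟩
    · exact ⟨hmon 0 0 n, by rw [h]; simpa using hmon_mem_hpiece 0 0 n, hmon_ne_zero 0 0 n⟩
  haveI : Nontrivial ↥(fockPiece k) := ⟨⟨⟨v, hvk⟩, 0, fun h => hv0 (congrArg Subtype.val h)⟩⟩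
  refine LieModule.IsIrreducible.mk fun N hN => ?_
  -- a nonzero vector of `N`
  obtain ⟨w, hwN, hw0⟩ : ∃ w : ↥(fockPiece k), w ∈ N ∧ w ≠ 0 := by
    by_contra h
    push Not at h
    exact hN ((LieSubmodule.eq_bot_iff N).mpr h)
  -- the image of `N` in `ℂ[z₁,z₂,w]` is `oscRep`-stable, hence contains `F_k`
  let M : Submodule ℂ HarmModel :=
    (N : Submodule ℂ ↥(fockPiece k)).map ((fockPiece k).incl : ↥(fockPiece k) →ₗ[ℂ] HarmModel)
  have hM : ∀ A : Matrix HarmVar HarmVar ℂ, ∀ f ∈ M, oscRep A f ∈ M := by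
    rintro A _ ⟨x, hx, rfl⟩
    exact ⟨⁅A, x⁆, N.lie_mem hx, rfl⟩
  have hle : hpiece k ≤ M :=
    hpiece_le_of_oscRep_stable k M hM ⟨w, hwN, rfl⟩ (fun h => hw0 (Subtype.ext h)) w.2
  rw [eq_top_iff]
  rintro x -
  obtain ⟨y, hy, hyx⟩ := hle x.2
  have : y = x := Subtype.ext hyx
  rwa [this] at hy

/-- the centre of `𝔤𝔩₃` acts on `F_k` by `k + 2` (subtype form) -/
theorem lie_one_fockPiece (k : ℤ) (v : ↥(fockPiece k)) :
    ⁅(1 : Matrix HarmVar HarmVar ℂ), v⁆ = ((k : ℂ) + 2) • v := by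
  apply Subtype.ext
  rw [LieSubmodule.coe_bracket, LieSubmodule.coe_smul, gl3_lie_apply, oscRep_one]
  exact oscZ_apply_of_mem v.2

/-- **The `F_k` are pairwise non-isomorphic `𝔤𝔩₃(ℂ)`-modules**: for `k ≠ k'` every `𝔤𝔩₃(ℂ)`-equivariant linear map
`F_k → F_{k'}` vanishes (the centre acts by `k + 2 ≠ k' + 2`). -/
theorem fockPiece_hom_eq_zero {k k' : ℤ} (hkk' : k ≠ k')
    (T : ↥(fockPiece k) →ₗ⁅ℂ, Matrix HarmVar HarmVar ℂ⁆ ↥(fockPiece k')) : T = 0 := by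
  apply LieModuleHom.ext
  intro v
  have h1 := T.map_lie (1 : Matrix HarmVar HarmVar ℂ) v
  rw [lie_one_fockPiece, lie_one_fockPiece, map_smul] at h1
  have h2 : ((k : ℂ) - k') • T v = 0 := by
    rw [sub_smul, sub_eq_zero]
    have h3 := congrArg (fun x => x - (2 : ℂ) • T v) h1
    simpa [add_smul] using h3
  rw [LieModuleHom.zero_apply]
  rcases smul_eq_zero.mp h2 with h | h
  · exact absurd (by exact_mod_cast sub_eq_zero.mp h) hkk'
  · exact h

end LieModuleStructure

section LieModuleStructureDef

/-- `ℂ[z₁,z₂,z₃]` as a Lie module over `𝔤𝔩₃(ℂ) = Matrix (Fin 3) (Fin 3) ℂ` through the polarisation representation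
`dERep` (scoped). -/
noncomputable scoped instance instLieRingModuleDef : LieRingModule (Matrix (Fin 3) (Fin 3) ℂ) DefModel :=
  LieRingModule.compLieHom DefModel dERep

/-- (Ported verbatim from the HodgeCMPerL package; no docstring in the source.) -/
theorem gl3_lie_apply_def (A : Matrix (Fin 3) (Fin 3) ℂ) (f : DefModel) : ⁅A, f⁆ = dERep A f := rfl

/-- (Ported verbatim from the HodgeCMPerL package; no docstring in the source.) -/
scoped instance instLieModuleDef : LieModule ℂ (Matrix (Fin 3) (Fin 3) ℂ) DefModel :=
  LieModule.compLieHom DefModel dERep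

/-- (Ported verbatim from the HodgeCMPerL package; no docstring in the source.) -/
theorem dERep_mem_dpiece (d : ℕ) (A : Matrix (Fin 3) (Fin 3) ℂ) : ∀ f ∈ dpiece d, dERep A f ∈ dpiece d := by
  intro f hf
  rw [dERep_apply, LinearMap.sum_apply]
  refine Submodule.sum_mem _ fun i _ => ?_
  rw [LinearMap.sum_apply]
  refine Submodule.sum_mem _ fun j _ => ?_
  rw [LinearMap.smul_apply]
  exact Submodule.smul_mem _ _ (dpiece_map_mem d (i, j) f hf)

/-- `dpiece d = Sym^d` IS Mathlib's `homogeneousSubmodule (Fin 3) ℂ d` -/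
theorem dpiece_eq_homogeneousSubmodule (d : ℕ) : dpiece d = homogeneousSubmodule (Fin 3) ℂ d := by
  ext f
  rw [mem_dpiece_iff_isHomogeneous, mem_homogeneousSubmodule]

/-- **`ℂ[z₁,z₂,z₃] = ⊕_{d ∈ ℕ} Sym^d`** (internal direct sum; the `U(1)`-isotypic decomposition `u ↦ u^d` of the
definite model). -/
theorem dpiece_isInternal : DirectSum.IsInternal fun d : ℕ => dpiece d := by
  have h : (fun d : ℕ => dpiece d) = homogeneousSubmodule (Fin 3) ℂ := funext dpiece_eq_homogeneousSubmodule
  rw [h]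
  letI := MvPolynomial.decomposition (σ := Fin 3) (R := ℂ)
  exact DirectSum.Decomposition.isInternal _

/-- the centre of `𝔤𝔩₃` acts on `Sym^d` by the degree `d` (`dERep 1 = Σ_a z_a ∂_a` is the Euler operator) -/
theorem dERep_one_apply_of_mem {d : ℕ} {f : DefModel} (hf : f ∈ dpiece d) :
    dERep (1 : Matrix (Fin 3) (Fin 3) ℂ) f = (d : ℂ) • f := by
  have h := (mem_wpiece_iff (fun _ => (1 : ℤ)) (d : ℤ) f).mp hf
  rw [weightOp_apply] at h
  rw [dERep_apply, LinearMap.sum_apply]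
  have : ∀ i : Fin 3, (∑ j, (1 : Matrix (Fin 3) (Fin 3) ℂ) i j • dE i j) f = X i * pderiv i f := by
    intro i
    rw [LinearMap.sum_apply, Finset.sum_eq_single i]
    · rw [LinearMap.smul_apply, Matrix.one_apply_eq, one_smul, dE_apply]
    · intro j _ hj
      rw [LinearMap.smul_apply, Matrix.one_apply_ne (Ne.symm hj), zero_smul]
    · intro hi
      exact absurd (Finset.mem_univ i) hi
  simp only [this]
  simp only [Int.cast_one, one_smul, Int.cast_natCast] at h
  exact h

/-- `Sym^d ℂ³` as a Lie submodule. -/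
noncomputable def symPiece (d : ℕ) : LieSubmodule ℂ (Matrix (Fin 3) (Fin 3) ℂ) DefModel :=
  { dpiece d with
    lie_mem := fun {A f} hf => dERep_mem_dpiece d A f hf }

/-- (Ported verbatim from the HodgeCMPerL package; no docstring in the source.) -/
theorem mem_symPiece (d : ℕ) (f : DefModel) : f ∈ symPiece d ↔ f ∈ dpiece d := Iff.rfl

/-- **`Sym^d ℂ³` is an irreducible Lie module over `𝔤𝔩₃(ℂ)`**, for every `d : ℕ`. -/
theorem symPiece_isIrreducible (d : ℕ) :
    LieModule.IsIrreducible ℂ (Matrix (Fin 3) (Fin 3) ℂ) ↥(symPiece d) := by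
  obtain ⟨v, hvd, hv0⟩ : ∃ v : DefModel, v ∈ dpiece d ∧ v ≠ 0 :=
    ⟨monomial (single 0 d) 1, (mem_dpiece_iff_isHomogeneous d _).mpr (isHomogeneous_monomial _ (by
      rw [degree_single])), by rw [Ne, monomial_eq_zero]; exact one_ne_zero⟩
  haveI : Nontrivial ↥(symPiece d) := ⟨⟨⟨v, hvd⟩, 0, fun h => hv0 (congrArg Subtype.val h)⟩⟩
  refine LieModule.IsIrreducible.mk fun N hN => ?_
  obtain ⟨w, hwN, hw0⟩ : ∃ w : ↥(symPiece d), w ∈ N ∧ w ≠ 0 := by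
    by_contra h
    push Not at h
    exact hN ((LieSubmodule.eq_bot_iff N).mpr h)
  let M : Submodule ℂ DefModel :=
    (N : Submodule ℂ ↥(symPiece d)).map ((symPiece d).incl : ↥(symPiece d) →ₗ[ℂ] DefModel)
  have hM : ∀ A : Matrix (Fin 3) (Fin 3) ℂ, ∀ f ∈ M, dERep A f ∈ M := by
    rintro A _ ⟨x, hx, rfl⟩
    exact ⟨⁅A, x⁆, N.lie_mem hx, rfl⟩
  have hle : dpiece d ≤ M :=
    dpiece_le_of_dERep_stable d M hM ⟨w, hwN, rfl⟩ (fun h => hw0 (Subtype.ext h)) w.2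
  rw [eq_top_iff]
  rintro x -
  obtain ⟨y, hy, hyx⟩ := hle x.2
  have : y = x := Subtype.ext hyx
  rwa [this] at hy

/-- the centre of `𝔤𝔩₃` acts on `Sym^d` by `d` (subtype form) -/
theorem lie_one_symPiece (d : ℕ) (v : ↥(symPiece d)) :
    ⁅(1 : Matrix (Fin 3) (Fin 3) ℂ), v⁆ = (d : ℂ) • v := by
  apply Subtype.ext
  rw [LieSubmodule.coe_bracket, LieSubmodule.coe_smul, gl3_lie_apply_def]
  exact dERep_one_apply_of_mem v.2

/-- **The `Sym^d ℂ³` are pairwise non-isomorphic `𝔤𝔩₃(ℂ)`-modules**: for `d ≠ d'` every equivariant linear map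
`Sym^d → Sym^{d'}` vanishes. -/
theorem symPiece_hom_eq_zero {d d' : ℕ} (hdd' : d ≠ d')
    (T : ↥(symPiece d) →ₗ⁅ℂ, Matrix (Fin 3) (Fin 3) ℂ⁆ ↥(symPiece d')) : T = 0 := by
  apply LieModuleHom.ext
  intro v
  have h1 := T.map_lie (1 : Matrix (Fin 3) (Fin 3) ℂ) v
  rw [lie_one_symPiece, lie_one_symPiece, map_smul] at h1
  have h2 : ((d : ℂ) - d') • T v = 0 := by
    rw [sub_smul, sub_eq_zero]
    exact h1
  rw [LieModuleHom.zero_apply]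
  rcases smul_eq_zero.mp h2 with h | h
  · exact absurd (by exact_mod_cast sub_eq_zero.mp h) hdd'
  · exact h

end LieModuleStructureDef

end Fock

end PerL34

end HodgeCM
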